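import Summits.SmoothPoincare4.SmoothPoincare4.Theorems.EntropyRungSubcylindricalRecognitionSingularFlow
import Literature.Geometry.Riemannian.RicciFlowShortTimeProofs
import Literature.Geometry.Riemannian.PerelmanEntropyMonotonicityProofs
import HarnessLib

/-!
# `stub_singularFlow` of line `ancient-sphere-rigidity` (crux `EntropyRung.SubcylindricalRecognition`,
# stmt-SmoothPoincare4-10869) — now UNCONDITIONAL

The registered stub `stub_singularFlow` (the singular Ricci flow of a closed 4-manifold with `R > 0`,
with curvature blow-up at `T < ∞`, `κ`-noncollapsing below `√T` and Perelman's `μ`-floor `μ ≥ ν_cyl + δ`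
at all times) was landed in conditional form as
`stub_singularFlow_of : ricciFlow_shortTime_existence → perelman_muEntropy_monotone → …`
(`EntropyRungSubcylindricalRecognitionSingularFlow.lean`, p72410). Both named facts have since been
DISCHARGED in the tree:

* F1 `Literature.Geometry.Riemannian.ricciFlow_shortTime_existence_holds`
  (`RicciFlowShortTimeProofs.lean`; Hamilton 1982 Thm. 4.2 via DeTurck and the quasilinear parabolic
  short-time theory of `Analysis/PDE/QuasilinearFinal.lean`),
* F2 `Literature.Geometry.Riemannian.perelman_muEntropy_monotone_holds`
  (`PerelmanEntropyMonotonicityProofs.lean`; Perelman 2002 (3.4), Topping 2006 (8.3.10)),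

so the stub holds outright. This file is the one-line specialisation; it proves the registered signature
verbatim, by name, in the namespace of the line's other landed stubs.
-/

noncomputable section

open scoped Manifold ContDiff Topology
open Set MeasureTheory
open Literature.Geometry.Lorentzian Literature.Geometry.Riemannian

namespace Summit.SmoothPoincare4.SmoothPoincare4.Theorems.SubcylindricalRecognition.AncientSphereRigidity

/-- **Stub 1a of line `ancient-sphere-rigidity`, unconditional: the singular flow with Perelman's floor.**
For a closed connected Riemannian 4-manifold `(M, g₀)` with `R > 0` and
`μ(g₀, τ) ≥ ν_cyl + δ` for all `τ > 0` (`ν_cyl = log 2 + ½ log π - 3/2`), the maximal Ricci flow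
`g(t)`, `t ∈ [0, T)`, from `g₀` exists with `T < ∞` forced by `R > 0`, its curvature is unbounded on
every `[t₀, T)`, it is `κ`-noncollapsed below scale `√T`, and the floor `μ(g(t), τ) ≥ ν_cyl + δ` holds at
every `t ∈ [0, T)` and every `τ > 0`. This is `stub_singularFlow_of` (p72410) with its two named-fact
hypotheses discharged by `ricciFlow_shortTime_existence_holds` (Hamilton 1982, Thm. 4.2) and
`perelman_muEntropy_monotone_holds` (Perelman 2002, (3.4)).
[cite: Hamilton1982, Thm. 4.2] [cite: Perelman2002, §3.1, (3.4); §4, Thm. 4.1] -/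
theorem stub_singularFlow :
    ∀ (M : Type) [TopologicalSpace M] [T2Space M] [SecondCountableTopology M]
      [ChartedSpace (EuclideanSpace ℝ (Fin 4)) M] [IsManifold (𝓡 4) ∞ M] [CompactSpace M]
      [ConnectedSpace M] [T3Space M] [MeasurableSpace M] [BorelSpace M]
      (g₀ : PseudoRiemannianMetric (𝓡 4) ∞ (EuclideanSpace ℝ (Fin 4)) (TangentSpace (𝓡 4) : M → Type _))
      [g₀.HasLeviCivita] (hg₀ : g₀.IsRiemannian),
      (∀ x : M, 0 < g₀.scalarCurvature x) →
      ∀ δ : ℝ, 0 < δ →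
      (∀ τ : ℝ, 0 < τ → ∀ f : M → ℝ, ContMDiff (𝓡 4) 𝓘(ℝ, ℝ) ∞ f →
        ∫ x, (4 * Real.pi * τ) ^ (-(4 : ℝ) / 2) * Real.exp (-f x)
          ∂(riemannianMeasure (g₀.toContMDiffRiemannianMetric hg₀)) = 1 →
        Real.log 2 + Real.log Real.pi / 2 - 3 / 2 + δ ≤
          ∫ x, (τ * (g₀.scalarCurvature x + g₀.gradSq f x) + f x - 4) *
            ((4 * Real.pi * τ) ^ (-(4 : ℝ) / 2) * Real.exp (-f x))
            ∂(riemannianMeasure (g₀.toContMDiffRiemannianMetric hg₀))) →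
      ∃ (T κ : ℝ), 0 < κ ∧
        ∃ (g : ℝ → PseudoRiemannianMetric (𝓡 4) ∞ (EuclideanSpace ℝ (Fin 4)) (TangentSpace (𝓡 4) : M → Type _))
          (cov : ℝ → CovariantDerivative (𝓡 4) (EuclideanSpace ℝ (Fin 4)) (TangentSpace (𝓡 4) : M → Type _)),
          IsMaximalRicciFlow g cov T ∧ g 0 = g₀ ∧
          (∀ C : ℝ, ∃ t₀ ∈ Set.Ico 0 T, ∀ t ∈ Set.Ico t₀ T, ¬ CurvatureBoundedBy (g t) (cov t) C) ∧
          (∀ r₀ : ℝ, 0 < r₀ → r₀ < Real.sqrt T → IsKappaNoncollapsed g cov (Set.Ico 0 T) κ r₀) ∧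
          (∀ t ∈ Set.Ico 0 T, ∀ τ : ℝ, 0 < τ →
            ((Real.log 2 + Real.log Real.pi / 2 - 3 / 2 + δ : ℝ) : EReal) ≤
              (g t).muEntropy (cov t) τ) :=
  stub_singularFlow_of ricciFlow_shortTime_existence_holds perelman_muEntropy_monotone_holds

end Summit.SmoothPoincare4.SmoothPoincare4.Theorems.SubcylindricalRecognition.AncientSphereRigidity

end
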